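import Mathlib.Analysis.SpecialFunctions.Log.Basic
import Mathlib.Data.Nat.Factorization.Basic
import Mathlib.RingTheory.Localization.Module
import Mathlib.Algebra.BigOperators.Finsupp.Basic
import HarnessLib

/-!
# Frobenioids I, Lemma 6.5 (i): the logarithms of the prime numbers are linearly independent over `ℚ`

Mochizuki, *The geometry of Frobenioids I: the general theory*, Kyushu J. Math. **62** (2008)
293–400, Lemma 6.5 (i), kurims text pp. 116–117 [cite: MochizukiFrdI2008, Lem. 6.5 (i) p.116]: "The real
numbers `log(p)`, where `p` ranges over the prime numbers, are linearly independent over `ℚ`", whose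
printed proof is "a formal consequence of the fact that `ℤ` is a unique factorization domain" (p. 117).
PROVED here exactly so: an integer relation `Σ n_p log p = 0` splits into `log ∏ p^{n_p⁺} = log ∏ p^{n_p⁻}`,
hence an equality of natural numbers with equal factorizations (Mathlib `Nat.prod_pow_factorization_eq_self`),
so `n_p⁺ = n_p⁻`; linear independence over `ℤ` transfers to `ℚ` (`LinearIndependent.iff_fractionRing`).
(Lemma 6.5 (ii), which needs Lang's transcendence theorem, is only typed, in `ArithmeticFrobenioids.lean`.)
No statement of the paper is strengthened.
-/

noncomputable section

namespace Literature.AlgebraicGeometry.Frobenioids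

open Finset

/-- Evaluation of the exponent vector `∑_{p ∈ s} single p (a p) : ℕ →₀ ℕ` at a prime of `s`.
[cite: MochizukiFrdI2008, Lem. 6.5 (i) p.116] -/
private theorem expVec_apply (s : Finset Nat.Primes) (a : Nat.Primes → ℕ) (q : Nat.Primes) (hq : q ∈ s) :
    (∑ p ∈ s, Finsupp.single (p : ℕ) (a p)) (q : ℕ) = a q := by
  classical
  rw [Finsupp.finsetSum_apply, Finset.sum_eq_single q]
  · rw [Finsupp.single_eq_same]
  · intro p _ hpq
    rw [Finsupp.single_eq_of_ne]
    exact fun h => hpq (Subtype.ext h).symm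
  · exact fun h => (h hq).elim

/-- The support of the exponent vector consists of primes. [cite: MochizukiFrdI2008, Lem. 6.5 (i) p.116] -/
private theorem prime_of_mem_support_expVec (s : Finset Nat.Primes) (a : Nat.Primes → ℕ) {q : ℕ}
    (hq : q ∈ (∑ p ∈ s, Finsupp.single (p : ℕ) (a p)).support) : q.Prime := by
  classical
  obtain ⟨p, _, hp⟩ := Finset.mem_biUnion.mp (Finsupp.support_finsetSum hq)
  rw [Finsupp.support_single_subset |> fun h => Finset.mem_singleton.mp (h hp)]
  exact p.2

/-- `∏_{p ∈ s} p^{a p}` is the product of the exponent vector. [cite: MochizukiFrdI2008, Lem. 6.5 (i) p.116] -/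
private theorem expVec_prod (s : Finset Nat.Primes) (a : Nat.Primes → ℕ) :
    (∑ p ∈ s, Finsupp.single (p : ℕ) (a p)).prod (fun q n => q ^ n) = ∏ p ∈ s, (p : ℕ) ^ a p := by
  classical
  rw [← Finsupp.prod_finsetSum_index (fun _ => rfl) (fun _ _ _ => pow_add _ _ _)]
  refine Finset.prod_congr rfl fun p _ => ?_
  rw [Finsupp.prod_single_index (pow_zero _)]

/-- Logarithm of `∏_{p ∈ s} p^{a p}`. [cite: MochizukiFrdI2008, Lem. 6.5 (i) p.116] -/
private theorem log_prod_pow (s : Finset Nat.Primes) (a : Nat.Primes → ℕ) :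
    Real.log ((∏ p ∈ s, (p : ℕ) ^ a p : ℕ) : ℝ) = ∑ p ∈ s, (a p : ℝ) * Real.log (p : ℕ) := by
  push_cast
  rw [Real.log_prod]
  · refine Finset.sum_congr rfl fun p _ => ?_
    rw [Real.log_pow]
  · intro p _
    exact pow_ne_zero _ (Nat.cast_ne_zero.mpr p.2.ne_zero)

/-- **Lemma 6.5 (i)** over `ℤ`: an integer relation `Σ n_p log p = 0` among logarithms of distinct primes
is trivial — by unique factorisation in `ℤ` (FrdI p. 117). [cite: MochizukiFrdI2008, Lem. 6.5 (i) p.117] -/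
theorem linearIndependent_int_log_primes : LinearIndependent ℤ fun p : Nat.Primes => Real.log (p : ℕ) := by
  classical
  rw [linearIndependent_iff']
  intro s g hg q hq
  -- split `g = g⁺ - g⁻`
  let a : Nat.Primes → ℕ := fun p => (g p).toNat
  let b : Nat.Primes → ℕ := fun p => (-g p).toNat
  have hab : ∀ p, (g p : ℝ) = (a p : ℝ) - (b p : ℝ) := fun p => by
    have : g p = (a p : ℤ) - (b p : ℤ) := (Int.toNat_sub_toNat_neg (g p)).symm
    exact_mod_cast this
  have hsum : ∑ p ∈ s, (a p : ℝ) * Real.log (p : ℕ) = ∑ p ∈ s, (b p : ℝ) * Real.log (p : ℕ) := by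
    have h0 : ∑ p ∈ s, ((a p : ℝ) - (b p : ℝ)) * Real.log (p : ℕ) = 0 := by
      rw [← hg]
      refine Finset.sum_congr rfl fun p _ => ?_
      rw [zsmul_eq_mul, hab]
    rw [← sub_eq_zero, ← Finset.sum_sub_distrib]
    simpa [sub_mul] using h0
  -- exponentiate: the two natural numbers `∏ p^{a p}`, `∏ p^{b p}` coincide
  have hAB : (∏ p ∈ s, (p : ℕ) ^ a p) = ∏ p ∈ s, (p : ℕ) ^ b p := by
    have hpos : ∀ c : Nat.Primes → ℕ, (0 : ℝ) < ((∏ p ∈ s, (p : ℕ) ^ c p : ℕ) : ℝ) := fun c => by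
      exact_mod_cast Finset.prod_pos fun (p : Nat.Primes) _ => pow_pos p.2.pos _
    have := Real.log_injOn_pos (hpos a) (hpos b) (by rw [log_prod_pow, log_prod_pow, hsum])
    exact_mod_cast this
  -- unique factorisation: the exponent vectors coincide
  have hvec : (∑ p ∈ s, Finsupp.single (p : ℕ) (a p)) = ∑ p ∈ s, Finsupp.single (p : ℕ) (b p) := by
    rw [← Nat.prod_pow_factorization_eq_self (fun q hq => prime_of_mem_support_expVec s a hq),
      ← Nat.prod_pow_factorization_eq_self (fun q hq => prime_of_mem_support_expVec s b hq),
      expVec_prod, expVec_prod, hAB]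
  have haq : a q = b q := by
    rw [← expVec_apply s a q hq, ← expVec_apply s b q hq, hvec]
  -- hence `g q = 0`
  have := Int.toNat_sub_toNat_neg (g q)
  change (a q : ℤ) - (b q : ℤ) = g q at this
  omega

/-- **Lemma 6.5 (i)** (PROVED): "The real numbers `log(p)`, where `p` ranges over the prime numbers, are
linearly independent over `ℚ`" (FrdI p. 116). [cite: MochizukiFrdI2008, Lem. 6.5 (i) p.116] -/
theorem linearIndependent_rat_log_primes : LinearIndependent ℚ fun p : Nat.Primes => Real.log (p : ℕ) :=
  (LinearIndependent.iff_fractionRing ℤ ℚ).mp linearIndependent_int_log_primes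

end Literature.AlgebraicGeometry.Frobenioids

end
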